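import Mathlib.RingTheory.Ideal.Maps
import Mathlib.RingTheory.Ideal.Colon
import Mathlib.Data.Finsupp.Basic
import Mathlib.Algebra.BigOperators.Finsupp.Basic
import HarnessLib

/-!
# Hu 2025 (arXiv:2507.21400v1), §6.4 «Proper transforms of defining relations in (℘_(kτ)𝔯_μ𝔰_h) and in (ℓ_k)» —
# Prop. 6.18 (headline clause + items (1)(1a)(1b)(2)(2a)(2b)(3)(4)) and Cor. 6.19: statements-first typing, file
# c = `S06WpEllBlowups/R108cEquationsWpEll.lean` of lit/PARTITION-HU.md row 108 —
# typed for lit/PARTITION-HU.md row 108 by res-type-081 (typer of record; M-Hu-min re-pointing line 2026-08-27T08:00:07Z) from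
# res-type-029's FILING-READY SPLIT v2 pre-draft (2026-08-27T04:4xZ) with res-type-081's T9 locator audit
# (HOME/plan/tools/res-type-081/hu/T9-AUDIT-row108.md); every locator below was re-read on the TeX chunks of record.
# Companion of files a/b (`R108aWpEllChart`, `R108bProp611Items`; the chart record `WpEllChart` is in a). THIS FILE IS
# SELF-CONTAINED (term level only): it does not import file a.

**STATUS OF THE SOURCE (D-0012 / D-0089): UNREFEREED PREPRINT UNDER ADJUDICATION.** [Hu2025] = arXiv:2507.21400v1;
held as `paper:arxiv-2507.21400` (TeX chunks; LOCATOR OF RECORD `C<cc>L<l>`, PDF page «p.N» next to it; render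
lit/res-lit-6/hu25/hu25_p120.png VIEWED: the items of Prop. 6.18 are PRINTED (1)(1a)(1b)(2)(2a)(2b) on p.120 and (3), (4)
on p.121 (proof ends «This proves (4)», C56L107); the TeX chunk p0053 shows bullets). Statements below are
`def … : Prop` CANDIDATES tagged `[claim: Hu2025, status: under-review]` — «STATUS: candidate statement under adjudication
(D-0012/D-0089); not asserted»; nothing is proved, nothing is asserted, no declaration takes a side. AI typing, weaker
than expert review.

## Carrier level
* The HEADLINE clause (C53L68–L75; p.120: «the scheme 𝒱̃_{(℘_(kτ)𝔯_μ𝔰_h)} ∩ 𝔙, as a closed subscheme of the chart 𝔙 is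
  defined by ℬ^gov_𝔙, ℬ^frb_𝔙, L_{𝔉,𝔙}») is typed over an abstract chart ring `A` with the ideal `vIdeal` of `𝒱̃ ∩ 𝔙`
  and the relation families ON THE CHART as explicit data — AS PRINTED the families are the proper transforms of §6.4
  C53L12–L18 («Applying Definition 5.4 [general-proper-transforms], we obtain the proper transforms on the chart 𝔙: B_𝔙,
  ∀ B ∈ ℬ^gov ∪ ℬ^frb; L_{𝔙,F}, ∀ F̄ ∈ 𝔉»), i.e. row 106's `Def5_4` (term-wise) — and with the OURS sibling
  `Prop6_18_defining_ours` (the ideal of `𝒱̃ ∩ 𝔙` is the STRICT transform = ζ-saturation of the total transform of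
  the ideal of `𝒱̃' ∩ 𝔙'`; row 106's `Def5_4_ours`). JOINT J3 = G-H2 (lit/PARTITION-HU.md §4) reads both.
* Items (1a)–(4) and Cor. 6.19 are statements about MONOMIAL TERMS `T^±_{𝔙,B}` of binomials in the variables `Var^+_𝔙`
  (C53L35–L36 «for any B = T^+_B − T^-_B ∈ ℬ^gov, we express B_𝔙 = T^+_{𝔙,B} − T^-_{𝔙,B}»; binomial terms are monic
  monomials, §4.2 C22L5–L6): typed on EXPONENT VECTORS `V →₀ ℕ` over the index type `V` of `Var^+_𝔙` (a-draft:
  `(𝕀⋆ ⊔ Λ⋆) ⊔ 𝔡^lt_𝔙`), with the two distinguished indices `ζ` («the exceptional parameter in Var^+_𝔙 such that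
  E ∩ 𝔙 = (ζ = 0)», C53L79–L81) and `y₁` resp. `y₀` («the proper transform of y'_1» / «of y'_0», C53L87, C53L108) as
  parameters; «square-free» = all exponents ≤ 1, «y ∤ T» = exponent 0 at `y`, «T linear in y» = exponent 1, «ζ ∣ T» =
  exponent ≥ 1, «deg» = total degree, «deg_y» = the exponent (C35L10–L11 «deg_x 𝐦»). The binomial families are indexed by
  abstract types `ιG` (= ℬ^gov, with its order `<` of §4 and the distinguished `B_(kτ)`, and the sub-family ℬ^gov_{F_k})
  and `ιR` (= ℬ^frb); rows 103–105 (I-R / I-GOV: `Bgov`, `Bngv`, `wpBinomial`, `blockG`) instantiate.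
* Item (3) quantifies over the ROUNDS `𝔯_μ` and `ρ_(kτ)` of §6.2 (row 107, eq. (6.7) Ω): only its chart-local
  consequence («T^+_{𝔙,B} is square-free for all B ∈ ℬ^gov and for any admissible chart 𝔙 of ℛ̃_{℘_k}») is typed here;
  «ρ_(kτ) < ∞» and the termination clauses are left as a named slot `Prop6_18_3_rounds` with explicit Prop parameters
  (owner: instantiate with row 107's carriers).

## Items ↦ declarations (FQ prefix `Literature.AlgebraicGeometry.Hu2025.Statements.S06WpEllBlowups.`)
* Prop. 6.18 headline C53L65–L75; p.120 ↦ `Prop6_18_defining` (AS PRINTED, relation families as data),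
  `Prop6_18_defining_ours` (strict-transform sibling); its proof sentence C54L20–L22; p.121 ↦ `C54L20` (the inference).
* frame C53L77–L81 (ζ), C53L85–L87 (chart (ξ_0 ≡ 1), y_1), C53L107–L108 (chart (ξ_1 ≡ 1), y_0) ↦ parameters.
* (1a) C53L91–L99 ↦ `Prop6_18_1a`; (1b) C53L101–L105 ↦ `Prop6_18_1b`; (2a) C53L112–L115 ↦ `Prop6_18_2a`;
  (2b) C53L117–L120 ↦ `Prop6_18_2b`; (3) C53L122–L133 ↦ `Prop6_18_3_rounds` (slot), `Prop6_18_3_sqfree`;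
  (4) C53L135–L139 ↦ `Prop6_18_4`; Cor. 6.19 C56L117–L126 ↦ `Cor6_19`.
* helpers (exponent level): `IsSquarefree` (Hu's «square-free», §4.2.4 C24L90–L98), `totalDeg` («deg»).
-/

noncomputable section

namespace Literature.AlgebraicGeometry.Hu2025.Statements.S06WpEllBlowups

universe u v

/-! ## Exponent-level vocabulary for monomial terms in `Var^+_𝔙` (OURS; C35L10–L11 «deg_x 𝐦», §4.2 C22L5–L6) -/

/-- **«square-free» for a monic monomial term** given by its exponent vector on the variables `Var^+_𝔙`: every
exponent is `≤ 1`. Hu's own definition, §4.2.4 (C24L90–L98; p.54): «A monomial 𝐦 is square-free if x² does not divide 𝐦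
for every coordinate variable x in the affine space. … suppose 𝔙 is a smooth affine variety with local free variables
(x_1,⋯,x_l), then a monomial 𝐦 in (x_1,⋯,x_l) is square-free if x² does not divide 𝐦 for every variable x in
(x_1,⋯,x_l).» Used by Prop. 6.18 (1a) «T^+_{𝔙,(kτ)} is square-free» (C53L91–L92).
[claim: Hu2025, status: under-review]
STATUS: candidate statement under adjudication (D-0012/D-0089); not asserted. -/
def IsSquarefree {V : Type v} (T : V →₀ ℕ) : Prop := ∀ x, T x ≤ 1

/-- **«deg (T)»**, the total degree of a monomial term given by its exponent vector (Prop. 6.18 (1a)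
«deg(T^+_{𝔙,(kτ)}) = deg(T^+_{𝔙',(kτ)}) − 1», C53L93). OURS vocabulary (standard).
[claim: Hu2025, status: under-review]
STATUS: candidate statement under adjudication (D-0012/D-0089); not asserted. -/
def totalDeg {V : Type v} (T : V →₀ ℕ) : ℕ := T.sum fun _ e => e

/-! ## Prop. 6.18, headline clause — `𝒱̃ ∩ 𝔙` is cut out by the proper transforms (JOINT J3 reads this) -/

/-- **Proposition 6.18, headline clause (C53L65–L75; p.120).** «Let the notation be as in Proposition 6.11 and be as
above. Let 𝔙 be any preferred admissible chart of ℛ̃_{(℘_(kτ)𝔯_μ𝔰_h)} (cf. Definition 6.12). Then, the scheme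
𝒱̃_{(℘_(kτ)𝔯_μ𝔰_h)} ∩ 𝔙, as a closed subscheme of the chart 𝔙 is defined by ℬ^gov_𝔙, ℬ^frb_𝔙, L_{𝔉,𝔙}.» AS PRINTED:
the relation families are the term-wise proper transforms of §6.4 C53L12–L18 (row 106 `Def5_4`), supplied as DATA
`govRel : ιG → A`, `frbRel : ιR → A`, `ellForm : ιF → A` on the chart ring `A`; `vIdeal` = the ideal of `𝒱̃ ∩ 𝔙`
(a-draft `WpEllChart.vIdeal`); `isPreferred` = Def. 6.12 for this chart. Typed: the ideal of `𝒱̃ ∩ 𝔙` is the ideal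
generated by the three families.
[claim: Hu2025, status: under-review]
STATUS: candidate statement under adjudication (D-0012/D-0089); not asserted. -/
def Prop6_18_defining {A : Type u} [CommRing A] {ιG ιR ιF : Type v} (isPreferred : Prop) (vIdeal : Ideal A)
    (govRel : ιG → A) (frbRel : ιR → A) (ellForm : ιF → A) : Prop :=
  isPreferred → vIdeal = Ideal.span (Set.range govRel ∪ Set.range frbRel ∪ Set.range ellForm)

/-- **Proposition 6.18, headline clause — OURS sibling (T5 / PARTITION-HU §6 (e)): `𝒱̃ ∩ 𝔙` as the STRICT transform.**
Same printed sentence (C53L65–L75; p.120), with «𝒱̃_{(℘_(kτ)𝔯_μ𝔰_h)}» read as the proper transform of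
`𝒱̃_{(℘_(kτ)𝔯_μ𝔰_{h−1})}` under the blow-up (C46/C47 construction, row 107): on the chart, the ideal of `𝒱̃ ∩ 𝔙` is the
ζ-saturation of the total transform `π^*(I') · A` of the ideal `I'` of `𝒱̃' ∩ 𝔙'` along the chart map `π^* : A' → A`
(row 106 `ChartStep.strictTransform` / `Def5_4_ours`; tree anchor `Resolution.MarkedIdeals.strictTransformIdeal`).
The claim typed: THAT ideal is generated by the three printed families. Joint J3 (G-H2) reads this next to
`Prop6_18_defining`.
[claim: Hu2025, status: under-review]
STATUS: candidate statement under adjudication (D-0012/D-0089); not asserted. -/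
def Prop6_18_defining_ours {A A' : Type u} [CommRing A] [CommRing A'] {ιG ιR ιF : Type v} (isPreferred : Prop)
    (π : A' →+* A) (ζ : A) (vIdeal' : Ideal A') (govRel : ιG → A) (frbRel : ιR → A) (ellForm : ιF → A) : Prop :=
  isPreferred →
    (⨆ n : ℕ, (vIdeal'.map π).colon ({ζ ^ n} : Set A)) =
      Ideal.span (Set.range govRel ∪ Set.range frbRel ∪ Set.range ellForm)

/-- **The proof sentence for Prop. 6.18's headline clause (C54L20–L22; PDF p.121 l.35–37; anchor by chunk + line).**
«Consider any preferred admissible chart 𝔙 of ℛ̃_{(℘_(kτ)𝔯_μ𝔰_h)}, lying over a preferred admissible chart of [sic] 𝔙' of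
ℛ̃_{(℘_(kτ)𝔯_μ𝔰_{h−1})}. By assumption, all the desired statements of the proposition hold over the chart 𝔙'. The statement
of the proposition on the defining equations of 𝒱̃_{(℘_(kτ)𝔯_μ𝔰_h)} ∩ 𝔙 follows straightforwardly from the inductive
assumption.» (Initial case C54L1–L7: «the statement about defining equations of ℛ̃_{(℘_(11)𝔯_1𝔰_0)} ∩ 𝔙 [sic: 𝒱̃] follows
from Proposition 5.16 with k = Υ».) Typed as the INFERENCE itself, in the shape of row 109's `C60L75`: from the parent's
defining equations `rels' : ι → A'` with `vIdeal' = span (range rels')`, the element-wise «proper transform of an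
equation» `pt : A' → A` (row 106 `Def5_4` / `Def5_4_poly`, AS PRINTED) and `𝒱̃ ∩ 𝔙` = the STRICT transform of `𝒱̃' ∩ 𝔙'`
(ζ-saturation of `π^*(vIdeal')`; row 107 constructs `𝒱̃` as the proper transform), CONCLUDE
`vIdeal = span (range (pt ∘ rels'))`. This is the sentence a J3 packet on Prop. 6.18 adjudicates; nothing here asserts it.
[claim: Hu2025, status: under-review]
STATUS: candidate statement under adjudication (D-0012/D-0089); not asserted. -/
def C54L20 {A A' : Type u} [CommRing A] [CommRing A'] {ι : Type v} (π : A' →+* A) (ζ : A) (pt : A' → A)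
    (rels' : ι → A') (vIdeal' : Ideal A') (vIdeal : Ideal A) : Prop :=
  vIdeal' = Ideal.span (Set.range rels') →
    vIdeal = (⨆ n : ℕ, (vIdeal'.map π).colon ({ζ ^ n} : Set A)) →
      vIdeal = Ideal.span (Set.range (pt ∘ rels'))

/-! ## Prop. 6.18 (1)(2): the terms of the governing binomials on the two charts of the ℘/ℓ blow-up -/

section Terms

variable {V : Type v} {ιG ιR : Type u}

/-- **Proposition 6.18 (1)(1a) (C53L85–L99; PDF p.120 items (1), (1a)).** Frame (1) C53L85–L87: «Suppose
𝔙 ⊂ (𝔙' × (ξ_0 ≡ 1)) ∩ ℛ̃_{(℘_(kτ)𝔯_μ𝔰_h)}. We let y_1 ∈ Var^+_𝔙 be the proper transform of y'_1. Then, we have» (1a)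
C53L91–L99: «T^+_{𝔙,(kτ)} is square-free, y_1 ∤ T^+_{𝔙,(kτ)}, and deg(T^+_{𝔙,(kτ)}) = deg(T^+_{𝔙',(kτ)}) − 1. Suppose
deg_{y'_1} T^-_{𝔙',(kτ)} = b for some integer b, positive by definition, then we have deg_ζ T^-_{𝔙,(kτ)} = b − 1 and
deg_{y_1} T^-_{𝔙,(kτ)} = b. Consequently, either T^-_{𝔙,(kτ)} is linear in y_1 or else ζ ∣ T^-_{𝔙,(kτ)}.» Frame
C53L77–L81: «Assume Z'_{φ_(kτ)μh} ∩ 𝔙' ≠ ∅. We let ζ = ζ_{𝔙,(kτ)μh} be the exceptional parameter in Var^+_𝔙 such that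
E_{(℘_(kτ)𝔯_μ𝔰_h)} ∩ 𝔙 = (ζ = 0).» Typed at exponent level: `V` = index type of `Var^+_𝔙` (identified with that of
`Var^+_{𝔙'}` away from the renamed pair, as in row 106), `ζ y₁ y₁' : V` the indices of ζ, y_1 (on 𝔙) and y'_1 (on 𝔙'),
`Tp Tm` / `Tp' Tm'` the exponent vectors of `T^±_{𝔙,(kτ)}` / `T^±_{𝔙',(kτ)}`; hypotheses `onChart0` (the chart is the
(ξ_0 ≡ 1) one) and `centreMeets` (Z' ∩ 𝔙' ≠ ∅). «positive by definition» is kept as the hypothesis `0 < b`; the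
«Consequently» alternative is typed under the same hypothesis (it is printed as a consequence of the `b`-clause).
«deg(T^+_𝔙) = deg(T^+_{𝔙'}) − 1» is rendered `totalDeg Tp + 1 = totalDeg Tp'` (the exact integer meaning; no truncated
ℕ-subtraction), likewise in (2a).
[claim: Hu2025, status: under-review]
STATUS: candidate statement under adjudication (D-0012/D-0089); not asserted. -/
def Prop6_18_1a (onChart0 centreMeets : Prop) (ζ y₁ y₁' : V) (Tp Tm Tp' Tm' : V →₀ ℕ) : Prop :=
  onChart0 → centreMeets →
    (IsSquarefree Tp ∧ Tp y₁ = 0 ∧ totalDeg Tp + 1 = totalDeg Tp') ∧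
    (∀ b : ℕ, 0 < b → Tm' y₁' = b → Tm ζ = b - 1 ∧ Tm y₁ = b ∧ (Tm y₁ = 1 ∨ 1 ≤ Tm ζ))

/-- **Proposition 6.18 (1b) (C53L101–L105; PDF p.120 item (1b)).** «Let B ∈ ℬ^gov with B > B_(kτ). Then, T^+_{𝔙,B} is
square-free and y_1 ∤ T^+_{𝔙,B}. Suppose B ∈ ℬ^gov_{F_k} and y_1 ∣ T^-_{𝔙,B}, then either T^-_{𝔙,B} is linear in y_1 or
ζ ∣ T^-_{𝔙,B}. Suppose B ∉ ℬ^gov_{F_k} and y_1 ∣ T^-_{𝔙,B}, then ζ ∣ T^-_{𝔙,B}.» Typed with the governing binomials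
indexed by `ιG`, their order `gt B B'` («B > B'», §4 order of row 104/105), the distinguished `Bkτ : ιG`, the block
predicate `inFk B` («B ∈ ℬ^gov_{F_k}»), and the chart terms `TpOf TmOf : ιG → (V →₀ ℕ)`.
[claim: Hu2025, status: under-review]
STATUS: candidate statement under adjudication (D-0012/D-0089); not asserted. -/
def Prop6_18_1b (onChart0 centreMeets : Prop) (ζ y₁ : V) (gt : ιG → ιG → Prop) (Bkτ : ιG) (inFk : ιG → Prop)
    (TpOf TmOf : ιG → (V →₀ ℕ)) : Prop :=
  onChart0 → centreMeets → ∀ B, gt B Bkτ →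
    (IsSquarefree (TpOf B) ∧ TpOf B y₁ = 0) ∧
    (inFk B → 1 ≤ TmOf B y₁ → (TmOf B y₁ = 1 ∨ 1 ≤ TmOf B ζ)) ∧
    (¬ inFk B → 1 ≤ TmOf B y₁ → 1 ≤ TmOf B ζ)

/-- **Proposition 6.18 (2)(2a) (C53L107–L115; PDF p.120 items (2), (2a)).** Frame (2) C53L107–L108: «Suppose
𝔙 ⊂ (𝔙' × (ξ_1 ≡ 1)) ∩ ℛ̃_{(℘_(kτ)𝔯_μ𝔰_h)}. We let y_0 ∈ Var^+_𝔙 be the proper transform of y'_0. Then, we have» (2a)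
C53L112–L115: «T^+_{𝔙,(kτ)} is square-free, y_0 ∤ T^-_{𝔙,(kτ)}, and deg(T^-_{𝔙,(kτ)}) = deg(T^-_{𝔙',(kτ)}) − 1.»
[claim: Hu2025, status: under-review]
STATUS: candidate statement under adjudication (D-0012/D-0089); not asserted. -/
def Prop6_18_2a (onChart1 centreMeets : Prop) (y₀ : V) (Tp Tm Tm' : V →₀ ℕ) : Prop :=
  onChart1 → centreMeets → IsSquarefree Tp ∧ Tm y₀ = 0 ∧ totalDeg Tm + 1 = totalDeg Tm'

/-- **Proposition 6.18 (2b) (C53L117–L120; PDF p.120 item (2b)).** «Let B ∈ ℬ^gov with B > B_(kτ). Then, T^+_{𝔙,B}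
is square-free. Suppose B ∈ ℬ^gov_{F_k}, then y_0 ∤ T^-_{𝔙,B}. Suppose B ∉ ℬ^gov_{F_k} and y_0 ∣ T^-_{𝔙,B}, then
ζ ∣ T^-_{𝔙,B}.»
[claim: Hu2025, status: under-review]
STATUS: candidate statement under adjudication (D-0012/D-0089); not asserted. -/
def Prop6_18_2b (onChart1 centreMeets : Prop) (ζ y₀ : V) (gt : ιG → ιG → Prop) (Bkτ : ιG) (inFk : ιG → Prop)
    (TpOf TmOf : ιG → (V →₀ ℕ)) : Prop :=
  onChart1 → centreMeets → ∀ B, gt B Bkτ →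
    IsSquarefree (TpOf B) ∧ (inFk B → TmOf B y₀ = 0) ∧ (¬ inFk B → 1 ≤ TmOf B y₀ → 1 ≤ TmOf B ζ)

/-! ## Prop. 6.18 (3): finiteness of the rounds and termination (slot) + its chart-local consequence -/

/-- **Proposition 6.18 (3), the rounds/termination clauses (C53L122–L131; PDF p.121 item (3)) — SLOT.** «ρ_(kτ) < ∞.
Moreover, for every B ∈ ℬ^gov with B ≤ B_(kτ), we have that B terminates on
ℛ̃_{(℘_(kτ)𝔯_{ρ_(kτ)})} = ℛ̃_{(℘_(kτ)𝔯_{ρ_(kτ)}𝔰_{σ_{(kτ)ρ_(kτ)}})}. In particular, for all B ∈ ℬ^gov with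
B ≤ B_(k𝔱_{F_k})}, B terminates on ℛ̃_{℘_k}.» The round count `ρ_(kτ)`, the schemes `ℛ̃_{(℘_(kτ)𝔯_ρ)}` and «terminates on
ℛ̃_…» (Def. 6.17 `Def6_17_all` of the a-draft) are row 107 / a-draft objects: typed here as a named slot with the three
printed clauses as explicit Prop parameters `rhoFinite` («ρ_(kτ) < ∞»), `terminatesUpTo B` («B terminates on
ℛ̃_{(℘_(kτ)𝔯_{ρ_(kτ)})}») and `terminatesOnWpK B` («B terminates on ℛ̃_{℘_k}»), over the order data `le B B'` («B ≤ B'»),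
`Bkτ`, `BkLast` (= `B_(k𝔱_{F_k})`). The owner instantiates (or re-types over row 107's Ω).
[claim: Hu2025, status: under-review]
STATUS: candidate statement under adjudication (D-0012/D-0089); not asserted. -/
def Prop6_18_3_rounds (rhoFinite : Prop) (le : ιG → ιG → Prop) (Bkτ BkLast : ιG)
    (terminatesUpTo terminatesOnWpK : ιG → Prop) : Prop :=
  rhoFinite ∧ (∀ B, le B Bkτ → terminatesUpTo B) ∧ (∀ B, le B BkLast → terminatesOnWpK B)

/-- **Proposition 6.18 (3), last clause (C53L132–L133; PDF p.121 item (3) end).** «Consequently, T^+_{𝔙,B} is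
square-free for all B ∈ ℬ^gov and for any admissible chart 𝔙 of ℛ̃_{℘_k}.» Chart-local, typed per chart: `isWpK` (the
stage of the chart is `℘_k`), `isAdmissible` (Def. 6.10), `TpOf B` the exponent vector of `T^+_{𝔙,B}`.
[claim: Hu2025, status: under-review]
STATUS: candidate statement under adjudication (D-0012/D-0089); not asserted. -/
def Prop6_18_3_sqfree (isWpK isAdmissible : Prop) (TpOf : ιG → (V →₀ ℕ)) : Prop :=
  isWpK → isAdmissible → ∀ B, IsSquarefree (TpOf B)

/-! ## Prop. 6.18 (4) and Cor. 6.19: the «linear in y_j or divisible by ζ» alternative -/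

/-- **Proposition 6.18 (4) (C53L135–L139; PDF p.121 item (4)).** «Consider any fixed term T_B of any given B ∈ ℬ^frb.
We can assume y_i' turns into ζ for some i ∈ {0, 1} and y_j is the proper transform of y_j' with j = {0,1} ∖ {i} [sic:
j ∈]. Suppose y_j ∣ T_{𝔙,B}, then either T_{𝔙,B} is linear in y_j or ζ ∣ T_{𝔙,B}.» Typed with the terms of the
𝔯𝔟-binomials on the chart as a family `termsOf : ιR → Finset (V →₀ ℕ)` (both terms of `B_𝔙`), `ζ yj : V`.
[claim: Hu2025, status: under-review]
STATUS: candidate statement under adjudication (D-0012/D-0089); not asserted. -/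
def Prop6_18_4 (centreMeets : Prop) (ζ yj : V) (termsOf : ιR → Finset (V →₀ ℕ)) : Prop :=
  centreMeets → ∀ B, ∀ T ∈ termsOf B, 1 ≤ T yj → (T yj = 1 ∨ 1 ≤ T ζ)

/-- **Corollary 6.19 (C56L117–L126; p.127).** «Let the setup and notation be as in Proposition 6.18. As in
Proposition 6.18 (4), we can assume y_i' turns into the exceptional variable ζ for some i ∈ {0, 1} and y_j is the proper
transform of y_j' with j = {0,1} ∖ {i}. Then for any binomial B ∈ ℬ^gov ⊔ ℬ^frb and any tern [sic] T_{𝔙,B} of B_𝔙, if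
y_j ∣ T_{𝔙,B}, then either T_{𝔙,B} is linear in y_j, or else, ζ ∣ T_{𝔙,B}.» (C56L112–L115: «The following is a
restatement of some statements of the preceding proposition … we isolate and state it as a corollary.») Typed over BOTH
families: `govTermsOf : ιG → Finset (V →₀ ℕ)`, `frbTermsOf : ιR → Finset (V →₀ ℕ)`.
[claim: Hu2025, status: under-review]
STATUS: candidate statement under adjudication (D-0012/D-0089); not asserted. -/
def Cor6_19 (centreMeets : Prop) (ζ yj : V) (govTermsOf : ιG → Finset (V →₀ ℕ))
    (frbTermsOf : ιR → Finset (V →₀ ℕ)) : Prop :=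
  centreMeets →
    (∀ B, ∀ T ∈ govTermsOf B, 1 ≤ T yj → (T yj = 1 ∨ 1 ≤ T ζ)) ∧
    (∀ B, ∀ T ∈ frbTermsOf B, 1 ≤ T yj → (T yj = 1 ∨ 1 ≤ T ζ))

end Terms

/-! ## Name concordance with lit/PARTITION-HU.md row 108 «expected decls» (alias; same content) -/

/-- **Proposition 6.18 under PARTITION-HU row 108's expected name `Prop6_18`** = its HEADLINE clause (alias of
`Prop6_18_defining`; C53L65–L75; p.120: «the scheme 𝒱̃_{(℘_(kτ)𝔯_μ𝔰_h)} ∩ 𝔙, as a closed subscheme of the chart 𝔙 is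
defined by ℬ^gov_𝔙, ℬ^frb_𝔙, L_{𝔉,𝔙}»), the clause JOINT J3 reads (§4/§7.2); items (1a)(1b)(2a)(2b)(3)(4) are
`Prop6_18_1a` … `Prop6_18_4`, the strict-transform sibling is `Prop6_18_defining_ours`.
[claim: Hu2025, status: under-review]
STATUS: candidate statement under adjudication (D-0012/D-0089); not asserted. -/
abbrev Prop6_18 {A : Type u} [CommRing A] {ιG ιR ιF : Type v} (isPreferred : Prop) (vIdeal : Ideal A)
    (govRel : ιG → A) (frbRel : ιR → A) (ellForm : ιF → A) : Prop :=
  Prop6_18_defining isPreferred vIdeal govRel frbRel ellForm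

end Literature.AlgebraicGeometry.Hu2025.Statements.S06WpEllBlowups

end
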